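import Literature.Geometry.Lorentzian.KerrData
import Literature.Geometry.Lorentzian.TameFamilyFarSurgery
import Summits.FinalStateConjecture.FinalStateConjecture.Theorems.SwallowTheDatumParametricKerrBurialLine
import HarnessLib

/-!
# Route `ExactKerrEnds`, crux `CensorshipAlongKerrEnds` (stmt-FinalStateConjecture-18521), line `Sketch`:
# the route-posited objects of the GLUED TWO-PARAMETER FAMILY (definitions only)

Line `Sketch` (idea `transplant-the-end`, tree `Cruxes/CensorshipAlongKerrEnds/Lines/Sketch.lean`, v3.4) Kerr-ends a
tame family `G : ℝ¹ → InitialDataSet (𝓡 3) X` of admissible data on an end `e` by a matched exterior Kerr gluing at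
a receding radius: a two-parameter family `H c R` (`‖c‖ < ε`, `R > R⋆`) of data which agree with `G c` off the far
region `e.far R`, are Dafermos–Rodnianski flat with masses `m c R`, and are an exact piece of an ingoing Kerr–Schild
chart beyond `4R`.  Three registered stubs of the crux (`stub_gluingAlongFamily`, `stub_reEndingAbsorption`, and the
LANDED `stub_recedingSelection`, `Theorems/ExactKerrEndsCensorshipAlongKerrEndsRecedingSelection.lean`) and the
line's composition speak about the SAME five predicates on such a family, so far only let-expanded inside each
signature.  This file declares them once, so that the stubs, their proofs and the composition can be stated over
importable vocabulary:

* `IsChartExactKerrBeyond e D ρ` — in the chart of `e`, beyond coordinate radius `ρ`, the datum `D` is the induced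
  data of an injective spacelike immersion of `exteriorRegion ρ` into a Kerr–Schild region `Kerr.region a r₀` with
  future unit normal (the conclusion shape of Corvino–Schoen 2006, Thm. 4, read on the chart components
  `AFEnd.hCoeff`, `AFEnd.kCoeff`; verbatim the predicate of the sibling crux `TameEscapeToKerrEnds`, whose landed
  `chartKerrEnd` takes it let-expanded);
* `gluedDom X ε R⋆` — the parameter domain `{‖c‖ < ε, R⋆ < R} × X`;
* `GluedStructure e G ε R⋆ m H` — masses continuous on the parameter domain, sections jointly smooth in
  `((c, R), x)` (`SmoothSectionsOn`), members agree with `G c` off `e.far R` (`AgreeAt`) and are DR-flat on `e` with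
  mass `m c R`;
* `JointConvergence e G Mf ε R⋆ m H` — `e.wDist (H c R) (G c)` and `|m c R − Mf c|` are small for ALL small `c` and
  large `R` simultaneously (the only uniformity the tameness of `G` supports);
* `UniformBound e G ε R⋆ H` — `e.wDist (H c R) (G c)` is bounded on the whole parameter domain;
* `EventuallyOnBands P ε R⋆ H` — a property `P` of data holds for `H c R` on every compact band `C ∌ 0` of the
  `ε`-ball beyond a threshold radius `R₂(C)`.

Nothing is asserted here.  References: Corvino–Schoen, J. Differential Geom. 73 (2006), Thm. 4; Dafermos–Rodnianski,
Clay lecture notes (2013), App. B.2.3 (the weighted distance); Christodoulou, CQG 16 (1999) A23, p. A24 (tame families).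
-/

-- the summit-side namespace `Summit.FinalStateConjecture.FinalStateConjecture.…` (summit = problem)
-- doubles the `FinalStateConjecture` path component by design; `dupNamespace` would flag every decl.
set_option linter.dupNamespace false

noncomputable section

open scoped Manifold ContDiff Topology ENNReal
open Set Function Filter Literature.Geometry.Lorentzian
open Summit.FinalStateConjecture.FinalStateConjecture.Theorems.SwallowTheDatum.ParametricKerrBurial
  (SmoothSectionsOn AgreeAt)

namespace Summit.FinalStateConjecture.FinalStateConjecture.Theorems.ExactKerrEnds

variable {X : Type} [TopologicalSpace X] [ChartedSpace E3 X] [IsManifold (𝓡 3) ∞ X]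

/-- **Chart-exact Kerr beyond radius `ρ`.** In the chart of the end `e`, beyond coordinate radius `ρ`, the datum
`D` is the induced data of an INJECTIVE spacelike immersion `ψ : exteriorRegion ρ → Kerr.region a r₀` into an
ingoing Kerr–Schild chart of mass `M ≥ 0`, with future unit normal `ν`: the chart components `AFEnd.hCoeff e D`,
`AFEnd.kCoeff e D` are the pull-backs of `Kerr.bilin M a` and of the second fundamental form of `ψ` along `ν`.
This is the conclusion shape of the exterior Kerr gluing of Corvino–Schoen (2006), Thm. 4, on the chart of one
end. [cite: CorvinoSchoen2006, Thm. 4] -/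
@[cite "CorvinoSchoen2006" "Thm. 4"]
def IsChartExactKerrBeyond [Kerr.Facts] (e : AFEnd X) (D : InitialDataSet (𝓡 3) X) (ρ : ℝ) : Prop :=
  ∃ (M a r₀ : ℝ) (hM : 0 ≤ M) (ψ : exteriorRegion ρ → Kerr.region a r₀) (ν : NormalField 𝓘(ℝ, E4) ψ),
    Injective ψ ∧
    (Kerr.smoothMetric M a r₀).IsSpacelikeImmersion 𝓘(ℝ, E3) ψ ∧
    (Kerr.smoothMetric M a r₀).IsFutureUnitNormal 𝓘(ℝ, E3)
      ((Kerr.timeOrientation M a r₀ hM).ofLE le_top) ψ ν ∧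
    (∀ (y : exteriorRegion ρ) (v w : E3),
      AFEnd.hCoeff e D (y : E3) v w =
        Kerr.bilin M a (ψ y : E4) (mfderiv 𝓘(ℝ, E3) 𝓘(ℝ, E4) ψ y v)
          (mfderiv 𝓘(ℝ, E3) 𝓘(ℝ, E4) ψ y w)) ∧
    (∀ [(Kerr.smoothMetric M a r₀).HasLeviCivita] (y : exteriorRegion ρ) (v w : E3),
      AFEnd.kCoeff e D (y : E3) v w =
        (Kerr.smoothMetric M a r₀).secondFundamentalForm 𝓘(ℝ, E3) ψ ν y v w)

/-- **The parameter domain of a glued family**, `{‖c‖ < ε, R⋆ < R} × X` as a subset of `(ℝ¹ × ℝ) × X` (the set on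
which joint smoothness of the sections is required). [folklore] -/
@[folklore]
def gluedDom (X : Type) (ε Rstar : ℝ) : Set ((EuclideanSpace ℝ (Fin 1) × ℝ) × X) :=
  {p | ‖p.1.1‖ < ε ∧ Rstar < p.1.2}

/-- **Structural clauses of a glued family** `H c R` over the family `G` on the end `e` (parameters `‖c‖ < ε`,
`R > R⋆`, masses `m c R`): the masses are continuous on the parameter domain, the sections `(h, k)` of `H c R` are
jointly smooth in `((c, R), x)` there, and each member agrees with `G c` off the far region `e.far R` and is
Dafermos–Rodnianski flat on `e` with mass `m c R`. [folklore] -/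
@[folklore]
def GluedStructure (e : AFEnd X) (G : EuclideanSpace ℝ (Fin 1) → InitialDataSet (𝓡 3) X) (ε Rstar : ℝ)
    (m : EuclideanSpace ℝ (Fin 1) → ℝ → ℝ) (H : EuclideanSpace ℝ (Fin 1) → ℝ → InitialDataSet (𝓡 3) X) : Prop :=
  ContinuousOn (fun q : EuclideanSpace ℝ (Fin 1) × ℝ ↦ m q.1 q.2) {q | ‖q.1‖ < ε ∧ Rstar < q.2} ∧
  SmoothSectionsOn (𝓘(ℝ, EuclideanSpace ℝ (Fin 1)).prod 𝓘(ℝ, ℝ))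
    (fun q : EuclideanSpace ℝ (Fin 1) × ℝ ↦ H q.1 q.2) (gluedDom X ε Rstar) ∧
  ∀ (c : EuclideanSpace ℝ (Fin 1)) (R : ℝ), ‖c‖ < ε → Rstar < R →
    (∀ x ∉ e.far R, AgreeAt (H c R) (G c) x) ∧ e.IsStronglyAsymptoticallyFlatDR (H c R) (m c R)

/-- **Joint convergence at `(0, ∞)`.** The weighted distance `e.wDist (H c R) (G c)` and the mass defect
`|m c R − Mf c|` are below any `η > 0` for ALL `‖c‖ < ε₁` and `R > R₁` simultaneously (`ε₁ ≤ ε`, `R₁ ≥ R⋆` depending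
on `η`) — the uniformity that the tameness of `G` (weighted continuity at `c = 0` only) supports.
[cite: DafermosRodnianski2013, App. B.2.3] -/
@[cite "DafermosRodnianski2013" "App. B.2.3"]
def JointConvergence (e : AFEnd X) (G : EuclideanSpace ℝ (Fin 1) → InitialDataSet (𝓡 3) X)
    (Mf : EuclideanSpace ℝ (Fin 1) → ℝ) (ε Rstar : ℝ)
    (m : EuclideanSpace ℝ (Fin 1) → ℝ → ℝ) (H : EuclideanSpace ℝ (Fin 1) → ℝ → InitialDataSet (𝓡 3) X) : Prop :=
  ∀ η : ℝ, 0 < η → ∃ ε₁ R₁ : ℝ, 0 < ε₁ ∧ ε₁ ≤ ε ∧ Rstar ≤ R₁ ∧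
    ∀ (c : EuclideanSpace ℝ (Fin 1)) (R : ℝ), ‖c‖ < ε₁ → R₁ < R →
      e.wDist (H c R) (G c) < ENNReal.ofReal η ∧ |m c R - Mf c| < η

/-- **Uniform weighted bound** on a glued family over its base on the whole parameter domain:
`e.wDist (H c R) (G c) ≤ B` for one finite `B`.  Beyond radius `R` the glued content is then weak field at its own
scale (scale-invariant size `≤ B / R`). [cite: DafermosRodnianski2013, App. B.2.3] -/
@[cite "DafermosRodnianski2013" "App. B.2.3"]
def UniformBound (e : AFEnd X) (G : EuclideanSpace ℝ (Fin 1) → InitialDataSet (𝓡 3) X) (ε Rstar : ℝ)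
    (H : EuclideanSpace ℝ (Fin 1) → ℝ → InitialDataSet (𝓡 3) X) : Prop :=
  ∃ B : ℝ, ∀ (c : EuclideanSpace ℝ (Fin 1)) (R : ℝ), ‖c‖ < ε → Rstar < R → e.wDist (H c R) (G c) ≤ ENNReal.ofReal B

/-- **A property of data holds for the members of a two-parameter family on compact bands, eventually in the
radius**: for every compact `C ∌ 0` inside the parameter ball of radius `ε` there is a threshold `R₂ ≥ R⋆` beyond
which `P (H c R)` for all `c ∈ C`. [folklore] -/
@[folklore]
def EventuallyOnBands (P : InitialDataSet (𝓡 3) X → Prop) (ε Rstar : ℝ)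
    (H : EuclideanSpace ℝ (Fin 1) → ℝ → InitialDataSet (𝓡 3) X) : Prop :=
  ∀ C : Set (EuclideanSpace ℝ (Fin 1)), IsCompact C → (0 : EuclideanSpace ℝ (Fin 1)) ∉ C →
    C ⊆ Metric.ball (0 : EuclideanSpace ℝ (Fin 1)) ε →
      ∃ R₂ : ℝ, Rstar ≤ R₂ ∧ ∀ c ∈ C, ∀ R : ℝ, R₂ < R → P (H c R)

namespace CensorshipAlongKerrEnds

/-- **Registered sub-goal `eventuallyOnBands_mono` of the crux item (stmt-FinalStateConjecture-18521): band-eventual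
properties are monotone under pointwise implication** — if `P ⇒ Q` pointwise and `P` holds for `H c R` on compact
bands eventually in `R`, so does `Q` (same thresholds).  In the registry's expanded vocabulary; the step of the line's
composition that turns "censored on bands" into "admissible ∧ Kerr-ended ∧ censored on bands". [folklore] -/
@[folklore]
theorem eventuallyOnBands_mono : ∀ (X : Type) [TopologicalSpace X] [ChartedSpace Literature.Geometry.Lorentzian.E3 X] [IsManifold (𝓡 3) ((⊤ : ℕ∞) : WithTop ℕ∞) X] (P Q : Literature.Geometry.Lorentzian.InitialDataSet (𝓡 3) X → Prop) (ε Rstar : ℝ) (H : EuclideanSpace ℝ (Fin 1) → ℝ → Literature.Geometry.Lorentzian.InitialDataSet (𝓡 3) X), (∀ D, P D → Q D) → (∀ C : Set (EuclideanSpace ℝ (Fin 1)), IsCompact C → (0 : EuclideanSpace ℝ (Fin 1)) ∉ C → C ⊆ Metric.ball (0 : EuclideanSpace ℝ (Fin 1)) ε → ∃ R₂ : ℝ, Rstar ≤ R₂ ∧ ∀ c ∈ C, ∀ R : ℝ, R₂ < R → P (H c R)) → ∀ C : Set (EuclideanSpace ℝ (Fin 1)), IsCompact C → (0 : EuclideanSpace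 ℝ (Fin 1)) ∉ C → C ⊆ Metric.ball (0 : EuclideanSpace ℝ (Fin 1)) ε → ∃ R₂ : ℝ, Rstar ≤ R₂ ∧ ∀ c ∈ C, ∀ R : ℝ, R₂ < R → Q (H c R) := by
  intro X _ _ _ P Q ε Rstar H hPQ hP C hC h0 hCε
  obtain ⟨R₂, hR₂, h⟩ := hP C hC h0 hCε
  exact ⟨R₂, hR₂, fun c hc R hR ↦ hPQ _ (h c hc R hR)⟩

/-- **`EventuallyOnBands` is monotone in the property** (short form of the registered `eventuallyOnBands_mono`).
[folklore] -/
@[folklore]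
theorem _root_.Summit.FinalStateConjecture.FinalStateConjecture.Theorems.ExactKerrEnds.EventuallyOnBands.mono
    {P Q : InitialDataSet (𝓡 3) X → Prop} {ε Rstar : ℝ}
    {H : EuclideanSpace ℝ (Fin 1) → ℝ → InitialDataSet (𝓡 3) X} (h : EventuallyOnBands P ε Rstar H)
    (hPQ : ∀ D, P D → Q D) : EventuallyOnBands Q ε Rstar H :=
  eventuallyOnBands_mono X P Q ε Rstar H hPQ h

end CensorshipAlongKerrEnds

end Summit.FinalStateConjecture.FinalStateConjecture.Theorems.ExactKerrEnds

end
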